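import Summits.CriticalPhenomena.PercolationContinuityZ3.Theorems.PercNearOneGluingNoHeavyLowerTailThreePartitionGridMatching
import Summits.CriticalPhenomena.PercolationContinuityZ3.Theorems.PercNearOneGluingNoHeavyLowerTailThreePartitionGridFibrePairing
import Summits.CriticalPhenomena.PercolationContinuityZ3.Theorems.PercNearOneGluingNoHeavyLowerTailThreePartitionGridHall
import HarnessLib.Audit

/-!
# `NoHeavyLowerTail` (crux stmt-CriticalPhenomena-4575), master-family hierarchy P3 (gen 34): the typed fibre-local token matching EXISTS on the
# BALANCED class — `#(a-sites) ≤ #(bad tokens)` — for all up-sets `𝒱, 𝒲` and every twist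

Support file (seat `prim-masterthm-p3`; `--supports stmt-CriticalPhenomena-4575`; memo
`run/shared/lean/prim/prim-masterthm/FROM-prim-masterthm-p3-g34-FIBRE-LOCAL-CERTIFICATE.md` §8c, HIERARCHY §41).  Generalises `…ThreePartitionGridTop`
(`𝒱 = ⊤`) with the same toolkit (`…ThreePartitionGridFibrePairing`).
THE CLASS.  Bad tokens `B = {x₁ ∈ 𝒱∖𝒲, x₃ ∈ 𝒲}` (the `N1` tokens not at a `P`-configuration) and a-sites `P′_a = {x₁ ∈ 𝒱∩𝒲, x₃ ∉ 𝒲}` (the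
`P`-configurations whose unit `a` is not taken by their own `N1` token).  In every x₂-fibre the bad tokens inject increasingly into the a-sites
(`exists_fibre_injection` with `(𝒜,ℬ) = (𝒱,𝒲)` on the folding fibre `(S₂ᶜ, τ∩S₂)`), so `#B ≤ #P′_a` always; the instance is BALANCED when
`#P′_a ≤ #B` (hence `=`): e.g. `𝒱 = ⊤`; `𝒲 = ↑w₀` principal with `𝒱` V-RED-terminal (memo §8c: a disjoint-support pair, landing `Y ↦ Y ∪ w₀`).
THE CONSTRUCTION (memo §8c).  (i) `N1∩P`, `N2∩P`, `N3∩T₂` self-serve.  (ii) Bad tokens land on unit `a` of a-sites inside their x₂-fibre; balanced ⇒ the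
landing is a BIJECTION `B → P′_a` of configurations (`Finset.surjOn_of_injOn_of_card_le`).  (iii) Every `N3` token off `T₂` is the mirror (swap parts 1,2) of an
a-site and exits to the `T₂` token at the mirror of its lander.  (iv) The `N2` tokens off `P` (`x₁ ∈ 𝒲∖𝒱, x₂ ∈ 𝒱`) take the FREE units `b`
(`x₁ ∈ 𝒱∩𝒲, x₂ ∉ 𝒱`) inside their x₃-fibre: `exists_fibre_injection` with `(𝒜,ℬ) = (𝒲,𝒱)` on the folding fibre `(S₁∪S₂, τ∖(S₁∪S₂))` (copy 2 is the
reflection of copy 1 there) — the Harris step `|𝒴∩𝒲∩𝒱| ≥ |𝒴∩𝒲∩σ𝒱|`.  **`typedMatchable_of_balanced`**.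
HONEST LABEL: one more class of the open conjecture `TypedGridMatching` (⟹ `GridTransport` ⟹ COMB-C3 ⟹ Sahi's `C₃`); the general case needs diversions of bad
tokens to `b`-units (memo §8d/§8e) and is OPEN; nothing here bears on the crux. [this work]
-/

noncomputable section

open Finset
open scoped symmDiff Classical

namespace Summit.CriticalPhenomena.PercolationContinuityZ3.Theorems.ThreePartition

variable {ι : Type*} [Fintype ι]

/-- On a folding fibre the reflection `a ↦ a ∆ M` is order-reversing (restated with the fibre condition as an equation). [folklore] -/
theorem symmDiff_subset_symmDiff_of_fibre {M u a b : Set ι} (ha : a \ M = u) (hb : b \ M = u) (hab : a ⊆ b) : b ∆ M ⊆ a ∆ M :=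
  Literature.Probability.Percolation.FoldingFibre.symmDiff_subset_symmDiff_of_subset
    (Literature.Probability.Percolation.FoldingFibre.mem_fibre.2 ha) (Literature.Probability.Percolation.FoldingFibre.mem_fibre.2 hb) hab

omit [Fintype ι] in
/-- For disjoint parts, the second part is recovered from the union: `S₂ = (S₁ ∪ S₂) \ S₁`. [folklore] -/
theorem snd_eq_union_sdiff_fst {q : Set ι × Set ι} (hq : Disjoint q.1 q.2) : q.2 = (q.1 ∪ q.2) \ q.1 := by
  ext x
  have hx : x ∈ q.1 → x ∉ q.2 := fun h1 h2 => Set.disjoint_left.1 hq h1 h2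
  simp only [Set.mem_sdiff, Set.mem_union]
  tauto

/-- **The typed matching on the balanced class** (memo §8c): if the a-sites are at most as many as the bad tokens (they are then equally many), then
`TypedMatchable τ 𝒱 𝒲`. [this work] -/
theorem typedMatchable_of_balanced (τ : Set ι) {𝒱 𝒲 : Set (Set ι)} (h𝒱 : IsUpperSet 𝒱) (h𝒲 : IsUpperSet 𝒲)
    (hbal : #((cfgs ι).filter fun q => cp₁ τ q ∈ 𝒱 ∧ cp₁ τ q ∈ 𝒲 ∧ cp₃ τ q ∉ 𝒲)
      ≤ #((cfgs ι).filter fun q => cp₁ τ q ∈ 𝒱 ∧ cp₁ τ q ∉ 𝒲 ∧ cp₃ τ q ∈ 𝒲)) :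
    TypedMatchable τ 𝒱 𝒲 := by
  -- bad tokens and a-sites as (opaque) sets of configurations
  obtain ⟨Bad, hBad⟩ : ∃ B : Finset (Set ι × Set ι), ∀ q, q ∈ B ↔ Disjoint q.1 q.2 ∧ cp₁ τ q ∈ 𝒱 ∧ cp₁ τ q ∉ 𝒲 ∧ cp₃ τ q ∈ 𝒲 :=
    ⟨(cfgs ι).filter fun q => cp₁ τ q ∈ 𝒱 ∧ cp₁ τ q ∉ 𝒲 ∧ cp₃ τ q ∈ 𝒲, fun q => by simp only [cfgs, mem_filter, mem_univ, true_and]⟩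
  obtain ⟨Site, hSite⟩ : ∃ S : Finset (Set ι × Set ι), ∀ q, q ∈ S ↔ Disjoint q.1 q.2 ∧ cp₁ τ q ∈ 𝒱 ∧ cp₁ τ q ∈ 𝒲 ∧ cp₃ τ q ∉ 𝒲 :=
    ⟨(cfgs ι).filter fun q => cp₁ τ q ∈ 𝒱 ∧ cp₁ τ q ∈ 𝒲 ∧ cp₃ τ q ∉ 𝒲, fun q => by simp only [cfgs, mem_filter, mem_univ, true_and]⟩
  have hcard : #Site ≤ #Bad := by
    refine le_trans (le_of_eq (congrArg Finset.card (Finset.ext fun q => ?_)))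
      (le_trans hbal (le_of_eq (congrArg Finset.card (Finset.ext fun q => ?_))))
    · rw [hSite]; simp only [cfgs, mem_filter, mem_univ, true_and]
    · rw [hBad]; simp only [cfgs, mem_filter, mem_univ, true_and]
  -- the two families of fibre injections
  have hL := fun S : Set ι => exists_fibre_injection h𝒱 h𝒲 Sᶜ (τ ∩ S)
  choose g hg using hL
  have hH := fun U : Set ι => exists_fibre_injection h𝒲 h𝒱 U (τ \ U)
  choose h hh using hH
  -- (ii) the landing on configurations
  let Lc : Set ι × Set ι → Set ι × Set ι := fun q => (((g q.2 (cp₁ τ q)) ∆ τ) \ q.2, q.2)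
  have hLc : ∀ q, q ∈ Bad → Lc q ∈ Site ∧ cp₁ τ (Lc q) = g q.2 (cp₁ τ q) ∧ cp₁ τ q ⊆ cp₁ τ (Lc q) := by
    intro q hq
    rw [hBad] at hq
    obtain ⟨hd, h1v, h1w, h3⟩ := hq
    have ha3 : cp₁ τ q ∆ q.2ᶜ ∈ 𝒲 := by rwa [← cp₃_eq_cp₁_symmDiff τ hd]
    obtain ⟨⟨hb0, hbv, hbw, hb3⟩, hab⟩ := (hg q.2).2 _ (cp₁_sdiff_compl_snd τ hd) h1v h1w ha3
    have hc1 : cp₁ τ (Lc q) = g q.2 (cp₁ τ q) := symmDiff_sdiff_symmDiff_of_fibre τ hb0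
    refine ⟨?_, hc1, by rw [hc1]; exact hab⟩
    rw [hSite]
    refine ⟨Set.disjoint_sdiff_left, by rw [hc1]; exact hbv, by rw [hc1]; exact hbw, ?_⟩
    show cp₃ τ ((((g q.2 (cp₁ τ q)) ∆ τ) \ q.2, q.2)) ∉ 𝒲
    rw [cp₃_mk_fst τ hb0]; exact hb3
  have hLmaps : Set.MapsTo Lc ↑Bad ↑Site := fun q hq => mem_coe.2 (hLc q (mem_coe.1 hq)).1
  have hLinj : Set.InjOn Lc ↑Bad := by
    intro q hq q' hq' hqq
    rw [mem_coe] at hq hq'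
    have hS : q.2 = q'.2 := (Prod.mk.inj hqq).2
    have hgg : g q.2 (cp₁ τ q) = g q.2 (cp₁ τ q') := by rw [← (hLc q hq).2.1, hqq, (hLc q' hq').2.1, hS]
    have memT : ∀ p : Set ι × Set ι, p ∈ Bad →
        cp₁ τ p ∈ {a : Set ι | a \ p.2ᶜ = τ ∩ p.2 ∧ a ∈ 𝒱 ∧ a ∉ 𝒲 ∧ a ∆ p.2ᶜ ∈ 𝒲} := by
      intro p hp
      rw [hBad] at hp
      exact ⟨cp₁_sdiff_compl_snd τ hp.1, hp.2.1, hp.2.2.1, by rw [← cp₃_eq_cp₁_symmDiff τ hp.1]; exact hp.2.2.2⟩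
    have h11 : cp₁ τ q = cp₁ τ q' := by
      have hq'T := memT q' hq'
      rw [← hS] at hq'T
      exact (hg q.2).1 (memT q hq) hq'T hgg
    have hfst : q.1 = q'.1 := by
      have e := congrArg (fun s => s ∆ τ) h11
      simpa only [cp₁, symmDiff_symmDiff_cancel_right] using e
    exact Prod.ext hfst hS
  have hne : Nonempty (Set ι × Set ι) := ⟨(∅, ∅)⟩
  have hLsurj : Set.SurjOn Lc ↑Bad ↑Site := surjOn_of_injOn_of_card_le Lc hLmaps hLinj hcard
  obtain ⟨Li, hLi, hLimaps⟩ : ∃ Li : Set ι × Set ι → Set ι × Set ι, Set.InvOn Li Lc ↑Bad ↑Site ∧ Set.MapsTo Li ↑Site ↑Bad :=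
    ⟨Function.invFunOn Lc ↑Bad, (Set.BijOn.mk hLmaps hLinj hLsurj).invOn_invFunOn, hLsurj.mapsTo_invFunOn⟩
  -- (iv) the move of the `N2` tokens off `P`
  let Cc : Set ι × Set ι → Set ι × Set ι := fun q =>
    (((h (q.1 ∪ q.2) (cp₁ τ q)) ∆ τ) ∩ (q.1 ∪ q.2), (q.1 ∪ q.2) \ (((h (q.1 ∪ q.2) (cp₁ τ q)) ∆ τ) ∩ (q.1 ∪ q.2)))
  have hCc : ∀ q : Set ι × Set ι, Disjoint q.1 q.2 → cp₁ τ q ∈ 𝒲 → cp₁ τ q ∉ 𝒱 → cp₂ τ q ∈ 𝒱 →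
      Disjoint (Cc q).1 (Cc q).2 ∧ (Cc q).1 ∪ (Cc q).2 = q.1 ∪ q.2 ∧ cp₁ τ (Cc q) = h (q.1 ∪ q.2) (cp₁ τ q) ∧
      cp₁ τ (Cc q) ∈ 𝒱 ∧ cp₁ τ (Cc q) ∈ 𝒲 ∧ cp₂ τ (Cc q) ∉ 𝒱 ∧ cp₃ τ (Cc q) = cp₃ τ q ∧
      cp₁ τ q ⊆ cp₁ τ (Cc q) ∧ cp₂ τ (Cc q) ⊆ cp₂ τ q := by
    intro q hd h1w h1v h2v
    have ha2 : cp₁ τ q ∆ (q.1 ∪ q.2) ∈ 𝒱 := by rwa [← cp₂_eq_cp₁_symmDiff_union τ hd]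
    obtain ⟨⟨hb0, hbw, hbv, hb2⟩, hab⟩ := (hh (q.1 ∪ q.2)).2 _ (cp₁_sdiff_union τ q) h1w h1v ha2
    have hdis : Disjoint (Cc q).1 (Cc q).2 := Set.disjoint_sdiff_right
    have hun : (Cc q).1 ∪ (Cc q).2 = q.1 ∪ q.2 := mk₃_union τ (q.1 ∪ q.2) _
    have hc1 : cp₁ τ (Cc q) = h (q.1 ∪ q.2) (cp₁ τ q) := symmDiff_inter_symmDiff_of_fibre τ hb0
    have hc2 : cp₂ τ (Cc q) = h (q.1 ∪ q.2) (cp₁ τ q) ∆ (q.1 ∪ q.2) := by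
      rw [cp₂_eq_cp₁_symmDiff_union τ hdis, hun, hc1]
    have hc3 : cp₃ τ (Cc q) = cp₃ τ q := by
      show ((Cc q).1 ∪ (Cc q).2)ᶜ ∆ τ = (q.1 ∪ q.2)ᶜ ∆ τ
      rw [hun]
    refine ⟨hdis, hun, hc1, by rw [hc1]; exact hbv, by rw [hc1]; exact hbw, by rw [hc2]; exact hb2, hc3, by rw [hc1]; exact hab, ?_⟩
    rw [hc2, cp₂_eq_cp₁_symmDiff_union τ hd]
    exact symmDiff_subset_symmDiff_of_fibre (cp₁_sdiff_union τ q) hb0 hab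
  -- the matching
  let Φ : (Set ι × Set ι) × Fin 3 → (Set ι × Set ι) × Fin 3 := fun t =>
    if t.2 = 0 then (if cp₁ τ t.1 ∈ 𝒲 then t else (Lc t.1, 0))
    else if t.2 = 1 then (if cp₁ τ t.1 ∈ 𝒱 then t else (Cc t.1, 1))
    else (if cp₃ τ t.1 ∈ 𝒲 then t else ((Li t.1.swap).swap, 2))
  have Φ0 : ∀ q, Φ (q, 0) = if cp₁ τ q ∈ 𝒲 then (q, 0) else (Lc q, 0) := fun q => by
    simp only [Φ, if_true]
  have Φ1 : ∀ q, Φ (q, 1) = if cp₁ τ q ∈ 𝒱 then (q, 1) else (Cc q, 1) := fun q => by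
    simp only [Φ, if_true]
    rw [if_neg (show ¬ ((1 : Fin 3) = 0) by decide)]
  have Φ2 : ∀ q, Φ (q, 2) = if cp₃ τ q ∈ 𝒲 then (q, 2) else ((Li q.swap).swap, 2) := fun q => by
    simp only [Φ]
    rw [if_neg (show ¬ ((2 : Fin 3) = 0) by decide), if_neg (show ¬ ((2 : Fin 3) = 1) by decide)]
  have hneg : ∀ q i, (q, i) ∈ negToks τ 𝒱 𝒲 ↔ Disjoint q.1 q.2 ∧ negCond τ 𝒱 𝒲 q i := by
    intro q i; simp only [negToks, cfgs, mem_filter, mem_product, mem_univ, and_true, true_and]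
  have hpos : ∀ q j, (q, j) ∈ posToks τ 𝒱 𝒲 ↔ Disjoint q.1 q.2 ∧ posCond τ 𝒱 𝒲 q j := by
    intro q j; simp only [posToks, cfgs, mem_filter, mem_product, mem_univ, and_true, true_and]
  have nc0 : ∀ q, negCond τ 𝒱 𝒲 q 0 ↔ cp₁ τ q ∈ 𝒱 ∧ cp₃ τ q ∈ 𝒲 := fun q => by simp [negCond]
  have nc1 : ∀ q, negCond τ 𝒱 𝒲 q 1 ↔ cp₁ τ q ∈ 𝒲 ∧ cp₂ τ q ∈ 𝒱 := fun q => by simp [negCond]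
  have nc2 : ∀ q, negCond τ 𝒱 𝒲 q 2 ↔ cp₂ τ q ∈ 𝒱 ∧ cp₂ τ q ∈ 𝒲 := fun q => by simp [negCond]
  have pc0 : ∀ q, posCond τ 𝒱 𝒲 q 0 ↔ cp₁ τ q ∈ 𝒱 ∧ cp₁ τ q ∈ 𝒲 := fun q => by simp [posCond]
  have pc1 : ∀ q, posCond τ 𝒱 𝒲 q 1 ↔ cp₁ τ q ∈ 𝒱 ∧ cp₁ τ q ∈ 𝒲 := fun q => by simp [posCond]
  have pc2 : ∀ q, posCond τ 𝒱 𝒲 q 2 ↔ cp₂ τ q ∈ 𝒱 ∧ cp₃ τ q ∈ 𝒲 := fun q => by simp [posCond]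
  -- (iii) the mirror of an `N3` token off `T₂` is an a-site; its lander
  have hExit : ∀ q : Set ι × Set ι, Disjoint q.1 q.2 → cp₂ τ q ∈ 𝒱 → cp₂ τ q ∈ 𝒲 → cp₃ τ q ∉ 𝒲 →
      Li q.swap ∈ Bad ∧ Lc (Li q.swap) = q.swap := by
    intro q hd h2v h2w h3
    have hsite : q.swap ∈ Site := by
      rw [hSite]
      refine ⟨hd.symm, h2v, h2w, ?_⟩
      show ((q.2 ∪ q.1)ᶜ ∆ τ) ∉ 𝒲
      rw [Set.union_comm]; exact h3
    exact ⟨mem_coe.1 (hLimaps (mem_coe.2 hsite)), hLi.2 (mem_coe.2 hsite)⟩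
  have cp₁_swap : ∀ p : Set ι × Set ι, cp₁ τ p.swap = cp₂ τ p := fun p => rfl
  have cp₂_swap : ∀ p : Set ι × Set ι, cp₂ τ p.swap = cp₁ τ p := fun p => rfl
  have cp₃_swap : ∀ p : Set ι × Set ι, cp₃ τ p.swap = cp₃ τ p := fun p => by
    show (p.2 ∪ p.1)ᶜ ∆ τ = (p.1 ∪ p.2)ᶜ ∆ τ
    rw [Set.union_comm]
  have cp₂_Lc : ∀ p : Set ι × Set ι, cp₂ τ (Lc p) = cp₂ τ p := fun p => rfl
  refine ⟨Φ, ?_, ?_⟩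
  · rintro ⟨q, i⟩ ht
    obtain ⟨hq, hn⟩ := (hneg q i).1 ht
    fin_cases i
    · simp only [Fin.zero_eta, Fin.isValue] at hn ⊢
      obtain ⟨h1v, h3⟩ := (nc0 q).1 hn
      rw [Φ0]
      by_cases h1 : cp₁ τ q ∈ 𝒲
      · rw [if_pos h1]
        exact ⟨(hpos q 0).2 ⟨hq, (pc0 q).2 ⟨h1v, h1⟩⟩, gle_refl τ q, Or.inl ⟨rfl, Or.inl ⟨rfl, rfl⟩⟩⟩
      · rw [if_neg h1]
        have hqB : q ∈ Bad := (hBad q).2 ⟨hq, h1v, h1, h3⟩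
        obtain ⟨hs, -, hsub⟩ := hLc q hqB
        rw [hSite] at hs
        exact ⟨(hpos _ 0).2 ⟨hs.1, (pc0 _).2 ⟨hs.2.1, hs.2.2.1⟩⟩, ⟨hsub, (cp₂_Lc q).le⟩, Or.inl ⟨rfl, Or.inl ⟨rfl, cp₂_Lc q⟩⟩⟩
    · simp only [Fin.mk_one, Fin.isValue] at hn ⊢
      obtain ⟨h1w, h2v⟩ := (nc1 q).1 hn
      rw [Φ1]
      by_cases h1 : cp₁ τ q ∈ 𝒱
      · rw [if_pos h1]
        exact ⟨(hpos q 1).2 ⟨hq, (pc1 q).2 ⟨h1, h1w⟩⟩, gle_refl τ q, Or.inr (Or.inl ⟨rfl, rfl, rfl⟩)⟩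
      · rw [if_neg h1]
        obtain ⟨hdis, -, -, hv, hw, -, h3, hsub1, hsub2⟩ := hCc q hq h1w h1 h2v
        exact ⟨(hpos _ 1).2 ⟨hdis, (pc1 _).2 ⟨hv, hw⟩⟩, ⟨hsub1, hsub2⟩, Or.inr (Or.inl ⟨rfl, rfl, h3⟩)⟩
    · simp only [Fin.reduceFinMk, Fin.isValue] at hn ⊢
      obtain ⟨h2v, h2w⟩ := (nc2 q).1 hn
      rw [Φ2]
      by_cases h3 : cp₃ τ q ∈ 𝒲
      · rw [if_pos h3]
        exact ⟨(hpos q 2).2 ⟨hq, (pc2 q).2 ⟨h2v, h3⟩⟩, gle_refl τ q, Or.inr (Or.inr ⟨rfl, Or.inr ⟨rfl, rfl⟩⟩)⟩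
      · rw [if_neg h3]
        obtain ⟨hcB, hLcc⟩ := hExit q hq h2v h2w h3
        have hcB' := hcB
        rw [hBad] at hcB'
        obtain ⟨hcd, hc1v, -, hc3⟩ := hcB'
        have e1 : cp₁ τ (Li q.swap).swap = cp₁ τ q := by
          rw [cp₁_swap, ← cp₂_Lc (Li q.swap), hLcc, cp₂_swap]
        have e2 : cp₂ τ (Li q.swap).swap ⊆ cp₂ τ q := by
          have hsub := (hLc _ hcB).2.2
          rw [hLcc] at hsub
          rw [cp₂_swap, ← cp₁_swap q]
          exact hsub
        refine ⟨(hpos _ 2).2 ⟨hcd.symm, (pc2 _).2 ⟨?_, ?_⟩⟩, ⟨e1.symm.le, e2⟩, Or.inr (Or.inr ⟨rfl, Or.inr ⟨rfl, e1⟩⟩)⟩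
        · rw [cp₂_swap]; exact hc1v
        · rw [cp₃_swap]; exact hc3
  · rintro ⟨q, i⟩ ht ⟨q', i'⟩ ht' hΦ
    obtain ⟨hq, hn⟩ := (hneg q i).1 ht
    obtain ⟨hq', hn'⟩ := (hneg q' i').1 ht'
    have htype : ∀ (p : Set ι × Set ι) (k : Fin 3), (Φ (p, k)).2 = k := by
      intro p k
      fin_cases k
      · simp only [Fin.zero_eta, Fin.isValue]; rw [Φ0]; split_ifs <;> rfl
      · simp only [Fin.mk_one, Fin.isValue]; rw [Φ1]; split_ifs <;> rfl
      · simp only [Fin.reduceFinMk, Fin.isValue]; rw [Φ2]; split_ifs <;> rfl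
    have hii : i = i' := by
      have e := congrArg Prod.snd hΦ
      rwa [htype, htype] at e
    subst hii
    fin_cases i
    · simp only [Fin.zero_eta, Fin.isValue] at hn hn' hΦ ⊢
      obtain ⟨h1v, h3⟩ := (nc0 q).1 hn
      obtain ⟨h1v', h3'⟩ := (nc0 q').1 hn'
      rw [Φ0, Φ0] at hΦ
      have hland : ∀ p : Set ι × Set ι, p ∈ Bad → cp₃ τ (Lc p) ∉ 𝒲 := fun p hp => by
        have hs := (hLc p hp).1
        rw [hSite] at hs
        exact hs.2.2.2
      by_cases h1 : cp₁ τ q ∈ 𝒲 <;> by_cases h1' : cp₁ τ q' ∈ 𝒲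
      · rw [if_pos h1, if_pos h1'] at hΦ; exact hΦ
      · rw [if_pos h1, if_neg h1'] at hΦ
        have e : q = Lc q' := congrArg Prod.fst hΦ
        have hc := hland q' ((hBad q').2 ⟨hq', h1v', h1', h3'⟩)
        rw [← e] at hc
        exact absurd h3 hc
      · rw [if_neg h1, if_pos h1'] at hΦ
        have e : Lc q = q' := congrArg Prod.fst hΦ
        have hc := hland q ((hBad q).2 ⟨hq, h1v, h1, h3⟩)
        rw [e] at hc
        exact absurd h3' hc
      · rw [if_neg h1, if_neg h1'] at hΦ
        have e : Lc q = Lc q' := congrArg Prod.fst hΦ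
        have hqq : q = q' := hLinj (mem_coe.2 ((hBad q).2 ⟨hq, h1v, h1, h3⟩)) (mem_coe.2 ((hBad q').2 ⟨hq', h1v', h1', h3'⟩)) e
        rw [hqq]
    · simp only [Fin.mk_one, Fin.isValue] at hn hn' hΦ ⊢
      obtain ⟨h1w, h2v⟩ := (nc1 q).1 hn
      obtain ⟨h1w', h2v'⟩ := (nc1 q').1 hn'
      rw [Φ1, Φ1] at hΦ
      by_cases h1 : cp₁ τ q ∈ 𝒱 <;> by_cases h1' : cp₁ τ q' ∈ 𝒱
      · rw [if_pos h1, if_pos h1'] at hΦ; exact hΦ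
      · rw [if_pos h1, if_neg h1'] at hΦ
        have e : q = Cc q' := congrArg Prod.fst hΦ
        have hc := (hCc q' hq' h1w' h1' h2v').2.2.2.2.2.1
        rw [← e] at hc
        exact absurd h2v hc
      · rw [if_neg h1, if_pos h1'] at hΦ
        have e : Cc q = q' := congrArg Prod.fst hΦ
        have hc := (hCc q hq h1w h1 h2v).2.2.2.2.2.1
        rw [e] at hc
        exact absurd h2v' hc
      · rw [if_neg h1, if_neg h1'] at hΦ
        have e : Cc q = Cc q' := congrArg Prod.fst hΦ
        obtain ⟨-, hun, hc1, -⟩ := hCc q hq h1w h1 h2v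
        obtain ⟨-, hun', hc1', -⟩ := hCc q' hq' h1w' h1' h2v'
        have hU : q.1 ∪ q.2 = q'.1 ∪ q'.2 := by rw [← hun, e, hun']
        have hhh : h (q.1 ∪ q.2) (cp₁ τ q) = h (q.1 ∪ q.2) (cp₁ τ q') := by rw [← hc1, e, hc1', hU]
        have memT : ∀ p : Set ι × Set ι, Disjoint p.1 p.2 → cp₁ τ p ∈ 𝒲 → cp₁ τ p ∉ 𝒱 → cp₂ τ p ∈ 𝒱 →
            cp₁ τ p ∈ {a : Set ι | a \ (p.1 ∪ p.2) = τ \ (p.1 ∪ p.2) ∧ a ∈ 𝒲 ∧ a ∉ 𝒱 ∧ a ∆ (p.1 ∪ p.2) ∈ 𝒱} := by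
          intro p hp hw hv h2
          exact ⟨cp₁_sdiff_union τ p, hw, hv, by rw [← cp₂_eq_cp₁_symmDiff_union τ hp]; exact h2⟩
        have h11 : cp₁ τ q = cp₁ τ q' := by
          have hq'T := memT q' hq' h1w' h1' h2v'
          rw [← hU] at hq'T
          exact (hh (q.1 ∪ q.2)).1 (memT q hq h1w h1 h2v) hq'T hhh
        have hfst : q.1 = q'.1 := by
          have e1 := congrArg (fun s => s ∆ τ) h11
          simpa only [cp₁, symmDiff_symmDiff_cancel_right] using e1
        have hsnd : q.2 = q'.2 := by
          rw [snd_eq_union_sdiff_fst hq, snd_eq_union_sdiff_fst hq', hU, hfst]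
        have hqq : q = q' := Prod.ext hfst hsnd
        rw [hqq]
    · simp only [Fin.reduceFinMk, Fin.isValue] at hn hn' hΦ ⊢
      obtain ⟨h2v, h2w⟩ := (nc2 q).1 hn
      obtain ⟨h2v', h2w'⟩ := (nc2 q').1 hn'
      rw [Φ2, Φ2] at hΦ
      have hexit : ∀ p : Set ι × Set ι, Disjoint p.1 p.2 → cp₂ τ p ∈ 𝒱 → cp₂ τ p ∈ 𝒲 → cp₃ τ p ∉ 𝒲 →
          cp₂ τ (Li p.swap).swap ∉ 𝒲 := by
        intro p hp hv hw h3
        have hcB := (hExit p hp hv hw h3).1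
        rw [hBad] at hcB
        rw [cp₂_swap]
        exact hcB.2.2.1
      by_cases h3 : cp₃ τ q ∈ 𝒲 <;> by_cases h3' : cp₃ τ q' ∈ 𝒲
      · rw [if_pos h3, if_pos h3'] at hΦ; exact hΦ
      · rw [if_pos h3, if_neg h3'] at hΦ
        have e : q = (Li q'.swap).swap := congrArg Prod.fst hΦ
        have hc := hexit q' hq' h2v' h2w' h3'
        rw [← e] at hc
        exact absurd h2w hc
      · rw [if_neg h3, if_pos h3'] at hΦ
        have e : (Li q.swap).swap = q' := congrArg Prod.fst hΦ
        have hc := hexit q hq h2v h2w h3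
        rw [e] at hc
        exact absurd h2w' hc
      · rw [if_neg h3, if_neg h3'] at hΦ
        have e : (Li q.swap).swap = (Li q'.swap).swap := congrArg Prod.fst hΦ
        have e' : Li q.swap = Li q'.swap := Prod.swap_injective e
        have e'' : q.swap = q'.swap := by
          rw [← (hExit q hq h2v h2w h3).2, ← (hExit q' hq' h2v' h2w' h3').2, e']
        have hqq : q = q' := Prod.swap_injective e''
        rw [hqq]

end Summit.CriticalPhenomena.PercolationContinuityZ3.Theorems.ThreePartition

end
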